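import Mathlib
import Summits.Langlands.Langlands.Theses.ParityBlindBianchi
import Summits.Langlands.Langlands.Theorems.ParityBlindBianchiIcosahedralQuadraticDescentFrobRoots
import Literature.NumberTheory.Automorphic.TunnellLemma
import Literature.NumberTheory.Automorphic.TunnellOctahedralGlobalProofs
import Literature.NumberTheory.Automorphic.AutomorphicRepsGLSatakeFlathProofs

/-!
# Icosahedral descent over the route's antecedents (crux `IcosahedralDescentLevelBC`, line `Sketch`)
# — descent along the anchor

The anchor step of uniform quadratic descent for an Artin representation `ρ : Γ_ℚ → GL₂(ℂ)`,
re-plumbed over the crux's own antecedents instead of the Arthur–Clozel named facts: `K₁/ℚ` is a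
quadratic Galois extension, `P₁` a cuspidal representation of `GL₂(𝔸_{K₁})` which is `π(ρ|_{K₁})`
almost everywhere (`IsPiOfArtinRep`) and at every place over the witness place `v₁`
(`FrobSatakeCompatibleAt`); `v₁` is unramified and split in `K₁`, `ρ` is unramified at `v₁` with
Frobenius roots `{1, 1}`.  Then:

* (i) quadratic descent (`QuadraticDescentGL2`, the `n = 2`, `[E:F] = 2` case of A–C III.4.2 (d))
  applied to `P₁`, whose Satake data are `Gal(K₁/ℚ)`-stable
  (`isGaloisStableSatakeAE_of_isPiOfArtinRep`), gives a cuspidal `π` on `GL₂(𝔸_ℚ)` of which `P₁` is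
  a weak base change lift;
* (ii) clause (b) of `QuadraticBaseChangeGL2` (strong lifting at the places unramified in `K₁`,
  A–C III.5.1 at `n = 2`) makes `π` unramified at `v₁` with `t_{π,v₁}^{f(w|v₁)} = t_{P₁,w} =
  β^{f(w|v₁)}` for a place `w ∣ v₁`, `β = {1, 1}` and `f(w|v₁) = 1`, so `t_{π,v₁} = {1, 1}`;
* (iii) the proved twist fact `exists_twist_quadraticSign_holds` gives `π♭ = π ⊗ η_{K₁/ℚ}` with
  Satake parameters `ε_{K₁/ℚ}(v) t_{π,v}` almost everywhere.

This is the landed `IcosahedralDescentLevel.anchor_descent` with `cuspidal_descent_cyclic` and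
`ArthurClozel1989_strongLifting_unramified` replaced by the route declarations.
-/

-- `Summit.Langlands.Langlands.…`: the repeated path component is the tree's layout (D-0017).
set_option linter.dupNamespace false

noncomputable section

open scoped MatrixGroups NumberField Polynomial Classical
open NumberField IsDedekindDomain Field Filter
open Literature.NumberTheory.Automorphic Literature.NumberTheory.GaloisRepresentations
open Summit.Langlands.Langlands.Theorems.IcosahedralQuadraticDescent
open Summit.Langlands.Langlands.Theses.ParityBlindBianchi

namespace Summit.Langlands.Langlands.Theorems.IcosahedralDescentLevelBC

/-- **Descent along the anchor field and the witness place, over the crux's antecedents.**  Given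
cuspidal `P₁` on `GL₂(𝔸_{K₁})`, `[K₁ : ℚ] = 2` Galois, compatible with `ρ|_{K₁}` almost everywhere
and at every place over `v₁`, where `v₁` is unramified in `K₁` with all places above it of residue
degree `1` and `ρ` is unramified at `v₁` with Frobenius roots `{1, 1}`: quadratic descent
(`QuadraticDescentGL2`) gives a cuspidal `π` on `GL₂(𝔸_ℚ)` of which `P₁` is a weak lift, clause (b)
of `QuadraticBaseChangeGL2` (strong lifting at unramified places, and descent of unramifiedness)
gives `t_{π,v₁} = {1, 1}` exactly, and the proved twist fact gives `π♭ = π ⊗ η_{K₁/ℚ}`. [folklore] -/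
theorem stub_anchorDescentBC (hQD : QuadraticDescentGL2) (hQBC : QuadraticBaseChangeGL2)
    (ρ : FramedArtinRep ℚ 2) (K₁ : Type) [Field K₁] [NumberField K₁] [IsGalois ℚ K₁]
    (h2 : Module.finrank ℚ K₁ = 2) (hK₁ : isCompact_glFiniteIntegralLevel 2 K₁)
    (P₁ : CuspidalAutomorphicRepData 2 K₁ hK₁) (hP₁ : IsPiOfArtinRep (ρ.restrictField K₁) P₁.1)
    (v₁ : HeightOneSpectrum (𝓞 ℚ)) (hunr₁ : Algebra.IsUnramifiedIn (𝓞 K₁) v₁.asIdeal)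
    (hdeg₁ : ∀ w : HeightOneSpectrum (𝓞 K₁), w.asIdeal.under (𝓞 ℚ) = v₁.asIdeal →
      w.asIdeal.inertiaDeg (𝓞 ℚ) = 1)
    (hcompat₁ : ∀ w : HeightOneSpectrum (𝓞 K₁), w.asIdeal.under (𝓞 ℚ) = v₁.asIdeal →
      FrobSatakeCompatibleAt (ρ.restrictField K₁) P₁.1 w)
    (hρ₁ : ρ.IsUnramifiedAt v₁) (hroots₁ : frobRoots ρ v₁ = {1, 1})
    (hQ : isCompact_glFiniteIntegralLevel 2 ℚ) :
    ∃ π πf : CuspidalAutomorphicRepData 2 ℚ hQ,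
      IsWeakBaseChangeLiftAE π.1 P₁.1 ∧ π.1.HasSatakeParamAt v₁ {1, 1} ∧
      ∀ᶠ v : HeightOneSpectrum (𝓞 ℚ) in cofinite, ∀ α : Multiset ℂ,
        π.1.HasSatakeParamAt v α → πf.1.HasSatakeParamAt v (α.map (quadraticSign K₁ v * ·)) := by
  -- (i) quadratic descent of `P₁` (its Satake data are `Gal(K₁/ℚ)`-stable)
  have hSU₁ : P₁.1.hasSatakeParamAt_unique := AutomorphicRepData.hasSatakeParamAt_unique_holds P₁.1
  have hstab : IsGaloisStableSatakeAE ℚ P₁.1 :=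
    isGaloisStableSatakeAE_of_isPiOfArtinRep ρ (eventually_isUnramifiedAt ρ) P₁.1 hSU₁ hP₁
  obtain ⟨π, hlift⟩ := hQD ℚ K₁ h2 hQ hK₁ P₁ hstab
  -- (iii) the twist `π♭ = π ⊗ η_{K₁/ℚ}`
  obtain ⟨πf, htw⟩ := exists_twist_quadraticSign_holds 2 ℚ K₁ h2 hQ π
  refine ⟨π, πf, hlift, ?_, htw⟩
  -- (ii) the Satake parameter of `π` at `v₁` is `{1, 1}`: clause (b) at `w ∣ v₁`, `f(w|v₁) = 1`
  have hSL := hQBC.2.1 ℚ K₁ h2 hQ hK₁ π P₁ hlift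
  obtain ⟨α₀, hα₀⟩ : π.1.IsUnramifiedAt v₁ :=
    hSL.2 v₁ hunr₁ fun w hw => (hcompat₁ w hw).imp fun _ h => h.1
  obtain ⟨w, hw⟩ := exists_above (E := K₁) v₁
  have hPw := hSL.1 w v₁ α₀ hw hunr₁ hα₀
  obtain ⟨hβcard, hPv⟩ := card_frobRoots_and_hasFrobCharpolyAt ρ hρ₁
  have e := satakeParam_eq_frob_pow ρ hρ₁ hβcard hPv hSU₁ hw (hcompat₁ w hw) hPw
  rw [hdeg₁ w hw, hroots₁] at e
  simp only [pow_one, Multiset.map_id'] at e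
  rw [← e]
  exact hα₀

end Summit.Langlands.Langlands.Theorems.IcosahedralDescentLevelBC

end
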